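import Literature.AnabelianGeometry.SemiGraphs.PSCGraphicitySub2
import Literature.AnabelianGeometry.SemiGraphs.PSCCuspidalCriterionProofs
import HarnessLib

/-!
# [CombGC] Theorem 1.6 sub-DAG, row T16-L13: the vertex quotients from [IUTchI] Rmk. 1.2.3 (iv)'s criterion

[IUTchI] Remark 1.2.3 (iv) (kurims p. 42) deduces the characterization of the vertex quotients
`M^unr-vert_G ↠ M^unr_G[v] ⊗ F_l` ("may be characterized as the maximal quotients [i.e., relative to
the relation of domination] among those elementary abelian quotients of `M^unr_G` that correspond to
verticially purely totally ramified coverings of `G`") "immediately" from the criterion "such a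
quotient `φ : M^unr_G ↠ Q` corresponds to a verticially purely totally ramified covering of `G` if and
only if there exists a vertex `v` of `G` such that `φ(M^unr_G[v]) = Q`, `φ(M^unr_G[v']) = 0` for all
vertices `v' ≠ v`" — abc-iut-L3-t4's typed fact `PSCDatum.ElementaryQuotientVerticiallyRamifiedIff`
(`PSCRamification.lean`).  Over the statements of `PSCGraphicitySub2.lean` (abc-iut-w4-d052, sub-DAG
row T16-L13) this file PROVES, from that criterion and the clause "[nontrivial!]" (no vertex quotient
is trivial — the `2·genus(v) > 0` rank input, `PSCGraphicitySub.UnrVertAbOfRank`, displayed here as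
the hypothesis `hK`):

* `vertexQuotientKer_le_unrVertAb`, `vertexQuotientKer_le_of_isElemAbUnrQuotient` — bookkeeping:
  `Ker_v ⊆ M^unr-vert`, and `Ker_v ⊆ H'` for every elementary abelian kernel `H'` containing the
  `Π_w`, `w ≠ v`;
* `vertexQuotientKer_injective_of_ne` — distinct vertices give distinct quotients
  (`VertexSetCharacterization` from "[nontrivial!]");
* `isVerticiallyPurelyTotallyRamified_of_kernel_eq` — a quotient whose restriction to `M^unr-vert`
  is onto with kernel `Ker_v` corresponds to a verticially purely totally ramified covering;
* `eq_of_isVerticiallyPurelyTotallyRamified_le` — and is MAXIMAL (minimal kernel) among those;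
* `vertexQuotientCharacterization_mp` — the forward implication of
  `PSCDatum.VertexQuotientCharacterization`, and `vertexSetCharacterization_of_ne`.

The converse implication (a maximal verticially-purely-totally-ramified elementary abelian quotient
restricts to `M^unr-vert` with kernel some `Ker_v`) needs, beyond the criterion, the free complement of
`M^unr-vert_G` in `M^unr_G` (`UnrVerticialSplitInjection`) to ENLARGE a non-maximal quotient by a
twist `φ ↦ (φ, q_v + λ ∘ pr_C)` with `λ` lifting `φ|_C` through `M^unr_G[v] ⊗ F_l ↠ Q` — left to the
row's prover (documented in the cell's sub-DAG file).  Proof-only (0 defs); plain profinite group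
theory over the interface; nothing here takes a side on [IUTchIII] Cor. 3.12.
[cite: Mochizuki2012, IUTchI Rmk 1.2.3(iv) p.42]
-/

noncomputable section

namespace Literature.AnabelianGeometry.SemiGraphs

namespace PSCDatum

open scoped Pointwise

universe u

variable {P : Type u} [Group P] [TopologicalSpace P] [IsTopologicalGroup P]

/-! ### Bookkeeping on `Ker_v` -/

/-- `M^unr_G[w] ⊆ M^unr-vert_G`. [cite: Mochizuki2012, IUTchI Rmk 1.2.3(iv) p.42] -/
theorem unrVertAbOf_le_unrVertAb (G : PSCDatum P) (w : G.graph.V) : G.unrVertAbOf w ≤ G.unrVertAb :=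
  (le_iSup (fun w => G.unrVertAbOf w) w).trans (Subgroup.le_topologicalClosure _)

/-- `E^unr_G ⊆ M^unr_G[w]` (preimages). [cite: Mochizuki2012, IUTchI Rmk 1.2.3(iv) p.42] -/
theorem unrAbKer_le_unrVertAbOf (G : PSCDatum P) (w : G.graph.V) : G.unrAbKer ≤ G.unrVertAbOf w :=
  le_sup_right.trans (Subgroup.le_topologicalClosure _)

/-- `Π_w ⊆ M^unr_G[w]` (preimages). [cite: Mochizuki2012, IUTchI Rmk 1.2.3(iv) p.42] -/
theorem vertGp_le_unrVertAbOf (G : PSCDatum P) (w : G.graph.V) : G.vertGp w ≤ G.unrVertAbOf w :=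
  le_sup_left.trans (Subgroup.le_topologicalClosure _)

/-- `Ker_v ⊆ M^unr-vert_G`. [cite: Mochizuki2012, IUTchI Rmk 1.2.3(iv) p.42] -/
theorem vertexQuotientKer_le_unrVertAb (G : PSCDatum P) (l : ℕ) (v : G.graph.V) :
    G.vertexQuotientKer l v ≤ G.unrVertAb := by
  unfold vertexQuotientKer
  refine Subgroup.topologicalClosure_minimal _ ?_ (Subgroup.isClosed_topologicalClosure _)
  refine sup_le (sup_le ((G.unrAbKer_le_unrVertAbOf v).trans (G.unrVertAbOf_le_unrVertAb v))
    (iSup_le fun w => G.unrVertAbOf_le_unrVertAb w.1)) ((Subgroup.closure_le _).mpr ?_)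
  rintro _ ⟨g, hg, rfl⟩
  exact pow_mem (G.unrVertAbOf_le_unrVertAb v hg) l

/-- For an open subgroup `H' ⊇ E^unr_G` containing `Π_w`: `M^unr_G[w] ⊆ H'` (preimages; `H'` is
closed). [cite: Mochizuki2012, IUTchI Rmk 1.2.3(iv) p.42] -/
theorem unrVertAbOf_le_of_vertGp_le (G : PSCDatum P) {H' : Subgroup P} (hopen : IsOpen (H' : Set P))
    (hE : G.unrAbKer ≤ H') {w : G.graph.V} (hw : G.vertGp w ≤ H') : G.unrVertAbOf w ≤ H' :=
  Subgroup.topologicalClosure_minimal _ (sup_le hw hE) (Subgroup.isClosed_of_isOpen _ hopen)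

/-- `Ker_v ⊆ H'` for every elementary abelian kernel `H'` (open, `⊇ E^unr_G`, containing the `l`-th
powers) which contains the `Π_w`, `w ≠ v`. [cite: Mochizuki2012, IUTchI Rmk 1.2.3(iv) p.42] -/
theorem vertexQuotientKer_le_of_isElemAbUnrQuotient (G : PSCDatum P) {l : ℕ} {H' : Subgroup P}
    (hH' : G.IsElemAbUnrQuotient l H') {v : G.graph.V}
    (hw : ∀ w : G.graph.V, w ≠ v → G.vertGp w ≤ H') : G.vertexQuotientKer l v ≤ H' := by
  obtain ⟨-, hopen, hE, hpow⟩ := hH'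
  unfold vertexQuotientKer
  refine Subgroup.topologicalClosure_minimal _ ?_ (Subgroup.isClosed_of_isOpen _ hopen)
  refine sup_le (sup_le hE (iSup_le fun w => G.unrVertAbOf_le_of_vertGp_le hopen hE (hw w.1 w.2)))
    ((Subgroup.closure_le _).mpr ?_)
  rintro _ ⟨g, -, rfl⟩
  exact hpow g

/-- If `H' ⊇ E^unr_G` is open and contains EVERY `Π_w`, then `M^unr-vert_G ⊆ H'`.
[cite: Mochizuki2012, IUTchI Rmk 1.2.3(iv) p.42] -/
theorem unrVertAb_le_of_forall_vertGp_le (G : PSCDatum P) {H' : Subgroup P}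
    (hopen : IsOpen (H' : Set P)) (hE : G.unrAbKer ≤ H') (hw : ∀ w : G.graph.V, G.vertGp w ≤ H') :
    G.unrVertAb ≤ H' :=
  Subgroup.topologicalClosure_minimal _
    (iSup_le fun w => G.unrVertAbOf_le_of_vertGp_le hopen hE (hw w))
    (Subgroup.isClosed_of_isOpen _ hopen)

/-! ### "[nontrivial!]" ⇒ distinct vertices give distinct quotients -/

/-- **`VertexSetCharacterization` from "[nontrivial!]"**: if no vertex quotient
`M^unr-vert_G ↠ M^unr_G[v] ⊗ F_l` is trivial, then `v ↦ Ker_v` is injective — `Ker_v = Ker_w` for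
`v ≠ w` would contain every `M^unr_G[u]`, hence all of `M^unr-vert_G`.
[cite: Mochizuki2012, IUTchI Rmk 1.2.3(iv) p.42] -/
theorem vertexQuotientKer_injective_of_ne (G : PSCDatum P) (l : ℕ)
    (hK : ∀ v : G.graph.V, G.vertexQuotientKer l v ≠ G.unrVertAb) :
    Function.Injective (G.vertexQuotientKer l) := by
  intro v w hvw
  by_contra hne
  apply hK v
  refine le_antisymm (G.vertexQuotientKer_le_unrVertAb l v) ?_
  -- every `unrVertAbOf u` lies in `Ker_v = Ker_w`
  have hmem : ∀ u : G.graph.V, G.unrVertAbOf u ≤ G.vertexQuotientKer l v := by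
    intro u
    by_cases huv : u = v
    · subst huv
      rw [hvw]
      unfold vertexQuotientKer
      exact ((le_iSup (fun x : {x : G.graph.V // x ≠ w} => G.unrVertAbOf x.1) ⟨u, hne⟩).trans
        (le_sup_right.trans le_sup_left)).trans (Subgroup.le_topologicalClosure _)
    · unfold vertexQuotientKer
      exact ((le_iSup (fun w : {w : G.graph.V // w ≠ v} => G.unrVertAbOf w.1) ⟨u, huv⟩).trans
        (le_sup_right.trans le_sup_left)).trans (Subgroup.le_topologicalClosure _)
  unfold unrVertAb
  exact Subgroup.topologicalClosure_minimal _ (iSup_le hmem)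
    (by unfold vertexQuotientKer; exact Subgroup.isClosed_topologicalClosure _)

/-- `G.VertexSetCharacterization` holds as soon as no vertex quotient is trivial (for the relevant
`l`). [cite: Mochizuki2012, IUTchI Rmk 1.2.3(iv) p.42] -/
theorem vertexSetCharacterization_of_ne (G : PSCDatum P)
    (hK : ∀ l : ℕ, G.Sigma = {l} → ∀ v : G.graph.V, G.vertexQuotientKer l v ≠ G.unrVertAb) :
    G.VertexSetCharacterization :=
  fun _ l hl => ⟨G.vertexQuotientKer_injective_of_ne l (hK l hl), hK l hl⟩

/-! ### The forward implication of `VertexQuotientCharacterization` -/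

section Forward

variable [CompactSpace P]

omit [CompactSpace P] in
/-- A quotient of `M^unr_G` by an elementary abelian kernel `H'` whose restriction to `M^unr-vert_G` is
onto (`M^unr-vert ⊔ H' = ⊤`) with kernel `Ker_v` kills the `Π_w`, `w ≠ v`, and satisfies
`Π_v ⊔ H' = ⊤`; by [IUTchI] Rmk. 1.2.3 (iv)'s criterion it "corresponds to a verticially purely
totally ramified covering". [cite: Mochizuki2012, IUTchI Rmk 1.2.3(iv) p.42] -/
theorem isVerticiallyPurelyTotallyRamified_of_kernel_eq (G : PSCDatum P)
    (hiff : G.ElementaryQuotientVerticiallyRamifiedIff) (hGs : G.IsSturdy) {l : ℕ} (hS : G.Sigma = {l})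
    {H' : Subgroup P} (hH' : G.IsElemAbUnrQuotient l H') {v : G.graph.V}
    (hsup : G.unrVertAb ⊔ H' = ⊤) (hinf : G.unrVertAb ⊓ H' = G.vertexQuotientKer l v) :
    G.IsVerticiallyPurelyTotallyRamified ⊤ H' := by
  obtain ⟨hnorm, hopen, hE, hpow⟩ := hH'
  haveI := hnorm
  have hKle : G.vertexQuotientKer l v ≤ H' := hinf ▸ inf_le_right
  have hw : ∀ w : G.graph.V, w ≠ v → G.vertGp w ≤ H' := by
    intro w hw
    refine ((G.vertGp_le_unrVertAbOf w).trans ?_).trans hKle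
    unfold vertexQuotientKer
    exact ((le_iSup (fun w : {w : G.graph.V // w ≠ v} => G.unrVertAbOf w.1) ⟨w, hw⟩).trans
      (le_sup_right.trans le_sup_left)).trans (Subgroup.le_topologicalClosure _)
  refine (hiff hGs l H' hS hnorm hopen hE hpow).mpr ⟨v, ?_, hw⟩
  -- `Π_v ⊔ H'` is an open (hence closed) subgroup containing `M^unr-vert ⊔ H' = ⊤`
  refine top_le_iff.mp ?_
  have hWo : IsOpen ((G.vertGp v ⊔ H' : Subgroup P) : Set P) := Subgroup.isOpen_mono le_sup_right hopen
  have hEW : G.unrAbKer ≤ G.vertGp v ⊔ H' := hE.trans le_sup_right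
  rw [← hsup]
  refine sup_le (G.unrVertAb_le_of_forall_vertGp_le hWo hEW fun w => ?_) le_sup_right
  by_cases hwv : w = v
  · subst hwv; exact le_sup_left
  · exact (hw w hwv).trans le_sup_right

/-- **Maximality**: with `H'`, `v` as above, every elementary abelian kernel `H'' ⊆ H'` that
"corresponds to a verticially purely totally ramified covering" equals `H'` — the vertex it ramifies
over must be `v` (else `H' = ⊤` and the `v`-quotient would be trivial), and then `H''` and `H'` have
the same index `[M^unr-vert_G : Ker_v]`. [cite: Mochizuki2012, IUTchI Rmk 1.2.3(iv) p.42] -/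
theorem eq_of_isVerticiallyPurelyTotallyRamified_le (G : PSCDatum P)
    (hiff : G.ElementaryQuotientVerticiallyRamifiedIff) (hGs : G.IsSturdy) {l : ℕ} (hS : G.Sigma = {l})
    (hK : ∀ v : G.graph.V, G.vertexQuotientKer l v ≠ G.unrVertAb)
    {H' : Subgroup P} (hH' : G.IsElemAbUnrQuotient l H') {v : G.graph.V}
    (hsup : G.unrVertAb ⊔ H' = ⊤) (hinf : G.unrVertAb ⊓ H' = G.vertexQuotientKer l v)
    {H'' : Subgroup P} (hH'' : G.IsElemAbUnrQuotient l H'')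
    (hram : G.IsVerticiallyPurelyTotallyRamified ⊤ H'') (hle : H'' ≤ H') : H'' = H' := by
  obtain ⟨hnorm, hopen, hE, hpow⟩ := hH'
  obtain ⟨hnorm'', hopen'', hE'', hpow''⟩ := hH''
  haveI := hnorm
  haveI := hnorm''
  have hKle : G.vertexQuotientKer l v ≤ H' := hinf ▸ inf_le_right
  have hw : ∀ w : G.graph.V, w ≠ v → G.vertGp w ≤ H' := by
    intro w hw
    refine ((G.vertGp_le_unrVertAbOf w).trans ?_).trans hKle
    unfold vertexQuotientKer
    exact ((le_iSup (fun w : {w : G.graph.V // w ≠ v} => G.unrVertAbOf w.1) ⟨w, hw⟩).trans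
      (le_sup_right.trans le_sup_left)).trans (Subgroup.le_topologicalClosure _)
  obtain ⟨v'', hv''sup, hv''⟩ := (hiff hGs l H'' hS hnorm'' hopen'' hE'' hpow'').mp hram
  -- the ramified vertex of `H''` is `v`
  have hvv : v'' = v := by
    by_contra hne
    have hPv : G.vertGp v ≤ H' := (hv'' v (Ne.symm hne)).trans hle
    have hall : ∀ w : G.graph.V, G.vertGp w ≤ H' := fun w => by
      by_cases hwv : w = v
      · subst hwv; exact hPv
      · exact hw w hwv
    have hA : G.unrVertAb ≤ H' := G.unrVertAb_le_of_forall_vertGp_le hopen hE hall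
    have htop : H' = ⊤ := top_le_iff.mp (hsup ▸ sup_le hA le_rfl)
    apply hK v
    rw [← hinf, htop, inf_top_eq]
  subst hvv
  -- `M^unr-vert ⊓ H'' = Ker_v` and `M^unr-vert ⊔ H'' = ⊤`
  have hinf'' : G.unrVertAb ⊓ H'' = G.vertexQuotientKer l v'' :=
    le_antisymm ((inf_le_inf_left _ hle).trans hinf.le)
      (le_inf (G.vertexQuotientKer_le_unrVertAb l v'')
        (G.vertexQuotientKer_le_of_isElemAbUnrQuotient ⟨hnorm'', hopen'', hE'', hpow''⟩ hv''))
  have hsup'' : G.unrVertAb ⊔ H'' = ⊤ :=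
    top_le_iff.mp (hv''sup ▸ sup_le_sup_right ((G.vertGp_le_unrVertAbOf v'').trans
      (G.unrVertAbOf_le_unrVertAb v'')) _)
  -- equal indices
  have hidx : ∀ {K : Subgroup P} [K.Normal], G.unrVertAb ⊔ K = ⊤ →
      K.index = (G.unrVertAb ⊓ K).relIndex G.unrVertAb := by
    intro K _ hK'
    rw [← Subgroup.relIndex_top_right, ← hK', Subgroup.relIndex_sup_right, inf_comm,
      Subgroup.inf_relIndex_right]
  have h1 := hidx hsup
  have h2 := hidx hsup''
  rw [hinf] at h1
  rw [hinf''] at h2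
  haveI : H'.FiniteIndex := finiteIndex_of_isOpen H' hopen
  have hmul := Subgroup.relIndex_mul_index hle
  rw [h1, ← h2] at hmul
  have hri : H''.relIndex H' = 1 := by
    have hne : H''.index ≠ 0 := by rw [h2, ← h1]; exact Subgroup.FiniteIndex.index_ne_zero
    exact (mul_left_eq_self₀.mp hmul).resolve_right hne
  exact le_antisymm hle (Subgroup.relIndex_eq_one.mp hri)

/-- **Row T16-L13, forward implication of `PSCDatum.VertexQuotientCharacterization`**: over
[IUTchI] Rmk. 1.2.3 (iv)'s criterion (`ElementaryQuotientVerticiallyRamifiedIff`) and "[nontrivial!]"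
(`hK`), an elementary abelian quotient of `M^unr_G` whose restriction to `M^unr-vert_G` is onto with
kernel `Ker(M^unr-vert_G ↠ M^unr_G[v] ⊗ F_l)` corresponds to a verticially purely totally ramified
covering and is maximal among such. [cite: Mochizuki2012, IUTchI Rmk 1.2.3(iv) p.42] -/
theorem vertexQuotientCharacterization_mp (G : PSCDatum P)
    (hiff : G.ElementaryQuotientVerticiallyRamifiedIff) (hGs : G.IsSturdy) {l : ℕ} (hS : G.Sigma = {l})
    (hK : ∀ v : G.graph.V, G.vertexQuotientKer l v ≠ G.unrVertAb)
    {H' : Subgroup P} (hH' : G.IsElemAbUnrQuotient l H')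
    (h : ∃ v : G.graph.V, G.unrVertAb ⊔ H' = ⊤ ∧ G.unrVertAb ⊓ H' = G.vertexQuotientKer l v) :
    G.IsVerticiallyPurelyTotallyRamified ⊤ H' ∧
      ∀ H'' : Subgroup P, G.IsElemAbUnrQuotient l H'' → G.IsVerticiallyPurelyTotallyRamified ⊤ H'' →
        H'' ≤ H' → H'' = H' := by
  obtain ⟨v, hsup, hinf⟩ := h
  exact ⟨G.isVerticiallyPurelyTotallyRamified_of_kernel_eq hiff hGs hS hH' hsup hinf,
    fun H'' hH'' hram hle =>
      G.eq_of_isVerticiallyPurelyTotallyRamified_le hiff hGs hS hK hH' hsup hinf hH'' hram hle⟩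

end Forward

end PSCDatum

end Literature.AnabelianGeometry.SemiGraphs

end
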